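import Mathlib
import Literature.NumberTheory.LFunctions.ZetaScrewSeriesProofs
import Literature.NumberTheory.LFunctions.ZetaScrewThm17Proofs
import Summits.RiemannHypothesis.RiemannHypothesis.Theorems.SoloInformedScrewVerified
import Summits.RiemannHypothesis.RiemannHypothesis.Theorems.SoloInformedScrewExplicit
import Summits.RiemannHypothesis.RiemannHypothesis.Theorems.SoloInformedScrewVisibility
import HarnessLib

/-!
# T49 — The screw-function theorems T43/T43′/T44 with Suzuki's series discharged

The named fact `Suzuki2023_thm11_series` (hypothesis `hS` of T43/T43′/T44) is a THEOREM of the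
tree: `Literature.NumberTheory.LFunctions.Suzuki2023_thm11_series_holds`
(`ZetaScrewSeriesProofs.lean`, via Suzuki2023 §2.2; a second proof through the explicit formula
is T48, `SoloInformedTentArch.lean`). This file restates the s7 theorems without that hypothesis:

* RH ⟺ `Ψ ≥ 0` (Suzuki2023 Thm 1.7) is ALSO a theorem of the tree (`Suzuki2023_thm17_holds`,
  `ZetaScrewThm17.zetaScrew_nonneg_of_RH`, `riemannHypothesis_of_zetaScrew_nonneg`); recorded here only
  as the contrapositive `not_riemannHypothesis_of_zetaScrew_neg` (one `t` with `Ψ(t) < 0` refutes RH).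
* `exists_zetaScrew_ge_neg_of_rhUpTo'`, `zetaScrew_ge_neg_eventually'` — T43 (verified height `T₀`
  ⇒ `Ψ(t) ≥ −C(1+cosh(t/2))log(T₀+2)/(T₀+1)`), hypothesis-free apart from `RHUpTo T₀`.
* `zetaScrew_ge_neg_hundredth'` — T43′: Platt–Trudgian + Hasanalizade–Shen–Wong ⇒ `Ψ(t) ≥ −1/100`
  for `|t| ≤ 26` (two named numerical facts remain, by design).
* `exists_zetaScrew_neg_of_lone_quartet'` — T44: a lone off-line quartet makes `Ψ` negative.
-/

noncomputable section

open scoped Real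
open Literature.NumberTheory.LFunctions

namespace Summit.RiemannHypothesis.RiemannHypothesis.Theorems

/-- **A negative value of Suzuki's screw function refutes RH.** -/
theorem not_riemannHypothesis_of_zetaScrew_neg {t : ℝ} (ht : zetaScrew t < 0) :
    ¬ RiemannHypothesis := fun hRH ↦
  not_lt.2 (ZetaScrewThm17.zetaScrew_nonneg_of_RH hRH t) ht

/-- **T43 without the series hypothesis**: a zero-window bound and `RHUpTo T₀` give
`Ψ(t) ≥ −64C₀(1 + cosh(t/2))log(T₀+2)/(T₀+1)`. -/
theorem zetaScrew_ge_neg_of_rhUpTo' {C₀ : ℝ} (hC₀ : 0 ≤ C₀)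
    (hW : ∀ u : ℝ, (zetaZeroCount (u + 1) : ℝ) - zetaZeroCount u ≤ C₀ * Real.log (|u| + 2))
    {T₀ : ℝ} (hT₀ : 1 ≤ T₀) (hRH : RHUpTo T₀) (t : ℝ) :
    -(64 * C₀ * (1 + Real.cosh (t / 2)) * Real.log (T₀ + 2) / (T₀ + 1)) ≤ zetaScrew t :=
  zetaScrew_ge_neg_of_rhUpTo Suzuki2023_thm11_series_holds hC₀ hW hT₀ hRH t

/-- **T43, absolute-constant form, without the series hypothesis.** -/
theorem exists_zetaScrew_ge_neg_of_rhUpTo' :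
    ∃ C : ℝ, 0 < C ∧ ∀ T₀ : ℝ, 1 ≤ T₀ → RHUpTo T₀ → ∀ t : ℝ,
      -(C * (1 + Real.cosh (t / 2)) * Real.log (T₀ + 2) / (T₀ + 1)) ≤ zetaScrew t := by
  obtain ⟨C, hC, h⟩ := exists_zetaScrew_ge_neg_of_rhUpTo
  exact ⟨C, hC, fun T₀ hT₀ hRH t ↦ h T₀ hT₀ hRH Suzuki2023_thm11_series_holds t⟩

/-- **T43, limit form, without the series hypothesis**: verification to large height recovers
`Ψ(t) ≥ −τ` for any `τ > 0`. -/
theorem zetaScrew_ge_neg_eventually' (t τ : ℝ) (hτ : 0 < τ) :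
    ∃ T₁ : ℝ, ∀ T₀ : ℝ, T₁ ≤ T₀ → RHUpTo T₀ → -τ ≤ zetaScrew t :=
  zetaScrew_ge_neg_eventually Suzuki2023_thm11_series_holds t τ hτ

/-- **T43′ without the series hypothesis**: Platt–Trudgian's verified height and the
Hasanalizade–Shen–Wong zero-counting bound give `Ψ(t) ≥ −1/100` for `|t| ≤ 26`. -/
theorem zetaScrew_ge_neg_hundredth' (hPT : platt_trudgian_numerical_rh)
    (hH : zetaZeroCount_hasanalizade_shen_wong) {t : ℝ} (ht : |t| ≤ 26) :
    -(1 / 100 : ℝ) ≤ zetaScrew t :=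
  zetaScrew_ge_neg_hundredth Suzuki2023_thm11_series_holds hPT hH ht

/-- **T44 without the series hypothesis**: a lone off-line quartet of zeros (clean window at every
height) makes Suzuki's screw function negative somewhere. -/
theorem exists_zetaScrew_neg_of_lone_quartet' {C₀ : ℝ} (hC₀ : 0 ≤ C₀)
    (hW : ∀ u : ℝ, (zetaZeroCount (u + 1) : ℝ) - zetaZeroCount u ≤ C₀ * Real.log (|u| + 2))
    {ρ₀ : ℂ} {η : ℝ} (hζ : riemannZeta ρ₀ = 0) (hρ₀ : ρ₀.re = 1 / 2 + η) (hη : 0 < η)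
    (hclean : ∀ H : ℝ, RHUpToExcept H η ρ₀.im) : ∃ t : ℝ, zetaScrew t < 0 :=
  exists_zetaScrew_neg_of_lone_quartet Suzuki2023_thm11_series_holds hC₀ hW hζ hρ₀ hη hclean

end Summit.RiemannHypothesis.RiemannHypothesis.Theorems

end
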